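import Mathlib.NumberTheory.Zsqrtd.Basic
import Mathlib.Data.Nat.Choose.Central
import Mathlib.Tactic.LinearCombination
import Mathlib.Tactic.FieldSimp
import Mathlib.Tactic.Ring
import Mathlib.Tactic.NormNum
import Summits.HodgeConjecture.HodgeConjecture.Theorems.Ring2AbelianAllNonsplitNormObstruction
import HarnessLib

/-!
# NSC(−2) seed census I (report `NSC-SEEDS-1.md`, prover 1 gen 57): the arithmetic behind the class test at the non-split anchor
# `P₀ = E³ × Ē³`, `E = ℂ/ℤ[ζ₃]`, polarisation weights `(2,1,1,1,1,1)` — four def-free heads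

Family `hodge`, b2b cell `hweil` (helper of item stmt-HodgeConjecture-2524; the cell target NSC(−2) = `Ring2.Hypotheses.WeilClassesComponent 3 3 [−2]`
is fed by the object `Ring2.AbelianAll.HasBlochSeedInClass 3 3 [−2]` of `Ring2AbelianAllWeilCellsBlochSeed.lean`). Report
`run/shared/lean/b2b/hodge-weil/b2b-hweil-pv1-g57/NSC-SEEDS-1.md`. Context (the report's words; only what is stated below is formalised):
a Bloch seed at `P₀` is an integral lci threefold `Z ⊂ P₀` whose class lies in `ℚh³ ⊕ W` (`W` the Weil plane) with non-zero `W`-part and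
which is Bloch-semiregular. The report proves (seat level) a CLASS TEST and several no-go lemmas; this file kernel-checks their arithmetic cores:

* `nsc1_ker_chi_weights` — LEMMA 3 (symmetry): a character `x_A y_B` of the diagonal torus `μ₆⁶ ⊂ Aut(E⁶)` with exponent vector
  `w ∈ {−1,0,1}⁶` is trivial on `S = {u : u₁u₂u₃ = u₄u₅u₆}` (the `K`-determinant-one torus) iff `w ∈ {0, ±(1,1,1,−1,−1,−1)}`; whence
  `H⁶(P₀)^S = ⟨e_S⟩ ⊕ W`, `H²(P₀)^S = ⟨e_i⟩`, and every `S`-symmetric complete intersection / `S`-equivariant bundle construction has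
  `W`-part `0` (report §2.3).
* `nsc1_one_add_psi_eigenvalues` — LEMMA 1 (the `K`-type test): on the `K`-type `(p,q)`, `p + q = 6`, the isogeny `1 + ψ₀` pulls back by
  `(1+√−3)^p (1−√−3)^q`, which equals `64 = 4³` exactly for `(p,q) ∈ {(6,0),(3,3),(0,6)}` = the `K`-types of `ℚh³ ⊕ W`; computed in `ℤ[√−3]`
  (`Zsqrtd (-3)`, `decide`).
* `nsc1_norm_form_cubic` — LEMMA 7 and the erratum to B3 (report §3.4): for `ζ² + ζ + 1 = 0`,
  `∏_{j=0,1,2} (T + ζ^{-j} a U + ζ^{j} ā V) = T³ − 3 a ā · T U V + a³ U³ + ā³ V³` — the class of the triple intersection of the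
  `ζ₃`-rotates of a divisor `bθ + a x² + ā y²` carries the parasitic term `−3 b a ā · θ·x²·y²`, which is NOT in `ℚθ³ ⊕ W`
  (exact linear algebra in the report; this identity is its algebraic half).
* `nsc1_no_norm_ratio_two` — LEMMA 4 (sub-torus galleries at the NON-SPLIT anchor): two Plücker coordinates of a `K`-rational
  3-plane cannot have norms `κ` and `2κ` with `κ ≠ 0`, because their ratio would have norm `2`, and `2 ∉ Nm(ℚ(√−3)ˣ)`
  (`Ring2AbelianAll.NonsplitNormObstruction.not_exists_sq_add_three_sq_eq_two`, imported); whence no `S`-orbit of translated abelian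
  threefolds in `P₀` has diagonal class proportional to `h³` (the weights `m_S ∈ {κ, 2κ}` are exactly this pattern).

* ADDENDUM 1 (`section NscSeedsOneAddendum`): `nsc1_cyclic_reciprocal_ne_zero` (THEOREM EQ″'s core: `1/p + 1/q + 1/r ≠ 0` for non-zero
  reals with `p + q + r = 0`) and `nsc1_centralBinom_gt_two` (THEOREM CUBE-n's core: `C(2n, n) > 2` for `n ≥ 2`, the existence of a third
  diagonal position in Jacobi's identity; report §10).

* ADDENDUM 2 (`section NscSeedsOneAddendumTwo`): `nsc1_prop_polarization` (THEOREM PROP's core — K-antisymmetric parts on one complex line: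
  the K-type-(5,1) relation substituted into the K-type-(4,2) relation leaves a sum of three positive semi-definite polarised adjugates;
  report §11).

HONEST FRAMING: census work for the seed object at ONE anchor; nothing here is a rung; no case of the Hodge conjecture is proved or claimed;
no statement of [Markman 2025] / [Perry 2026] is used. [cite: vanGeemen1994HodgeAV, 4.14 and (5.4.1)]
[cite: Bloch1972Semiregularity, Remark (7.5)]
-/

-- mandated namespace `Summit.HodgeConjecture.HodgeConjecture.…` (Problem = Summit) trips `linter.dupNamespace`; the lakefile disables it
-- tree-wide (weak option), restated here so stand-alone elaboration is warning-free too.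
set_option linter.dupNamespace false

namespace Summit.HodgeConjecture.HodgeConjecture.WeilTypeLadder

section NscSeedsOne

/-- **NSC-SEEDS-1 LEMMA 3 (the `K`-determinant-one torus sees only the diagonal classes and the Weil plane).** Exponent vectors
`w ∈ {−1,0,1}⁶` of torus characters occurring in `H^*(E⁶)` (`x_i ↦ +1`, `y_i ↦ −1` at place `i`); the subgroup
`S = {u ∈ μ₆⁶ : u₁u₂u₃ = u₄u₅u₆}` is generated (additively in `(ℤ/6)⁶`) by `(1,−1,0,0,0,0)`, `(0,1,−1,0,0,0)`, `(0,0,0,1,−1,0)`,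
`(0,0,0,0,1,−1)`, `(1,0,0,1,0,0)`; a character is trivial on `S` iff it kills these five generators mod `6`, iff
`w = c·(1,1,1,−1,−1,−1)` with `c ∈ {−1,0,1}` — i.e. the monomial is diagonal (`c = 0`: `x_A y_A`) or one of the two Weil generators.
[`omega`] -/
theorem nsc1_ker_chi_weights (w₁ w₂ w₃ w₄ w₅ w₆ : ℤ)
    (h₁ : -1 ≤ w₁ ∧ w₁ ≤ 1) (h₂ : -1 ≤ w₂ ∧ w₂ ≤ 1) (h₃ : -1 ≤ w₃ ∧ w₃ ≤ 1)
    (h₄ : -1 ≤ w₄ ∧ w₄ ≤ 1) (h₅ : -1 ≤ w₅ ∧ w₅ ≤ 1) (h₆ : -1 ≤ w₆ ∧ w₆ ≤ 1) :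
    ((6 : ℤ) ∣ (w₁ - w₂) ∧ (6 : ℤ) ∣ (w₂ - w₃) ∧ (6 : ℤ) ∣ (w₄ - w₅) ∧ (6 : ℤ) ∣ (w₅ - w₆) ∧ (6 : ℤ) ∣ (w₁ + w₄)) ↔
      ∃ c : ℤ, (-1 ≤ c ∧ c ≤ 1) ∧ w₁ = c ∧ w₂ = c ∧ w₃ = c ∧ w₄ = -c ∧ w₅ = -c ∧ w₆ = -c := by
  constructor
  · rintro ⟨d₁, d₂, d₃, d₄, d₅⟩
    refine ⟨w₁, ⟨h₁.1, h₁.2⟩, rfl, ?_, ?_, ?_, ?_, ?_⟩ <;> omega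
  · rintro ⟨c, -, rfl, rfl, rfl, rfl, rfl, rfl⟩
    refine ⟨?_, ?_, ?_, ?_, ?_⟩ <;> simp

/-- **NSC-SEEDS-1 LEMMA 1 (the `K`-type test by one isogeny).** In `ℤ[√−3]` (`Zsqrtd (-3)`, `√−3 = sqrtd`): the pull-back factor of
`1 + ψ₀` on the `K`-type `(p, q)` of `H⁶` is `(1+√−3)^p (1−√−3)^q`; it equals `64` for `(6,0)`, `(3,3)`, `(0,6)` and equals
`−32 + 32√−3`, `−32 − 32√−3`, `−32 − 32√−3`, `−32 + 32√−3` (all `≠ 64`) for `(4,2)`, `(5,1)`, `(2,4)`, `(1,5)`. Hence a class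
`z ∈ H⁶(P₀)` lies in the `K`-types of `ℚh³ ⊕ W` iff `(1+ψ₀)^* z = 64·z`. [`decide`] -/
theorem nsc1_one_add_psi_eigenvalues :
    ((1 : ℤ√(-3)) + Zsqrtd.sqrtd) ^ 6 = 64 ∧
    ((1 : ℤ√(-3)) + Zsqrtd.sqrtd) ^ 3 * (1 - Zsqrtd.sqrtd) ^ 3 = 64 ∧
    ((1 : ℤ√(-3)) - Zsqrtd.sqrtd) ^ 6 = 64 ∧
    ((1 : ℤ√(-3)) + Zsqrtd.sqrtd) ^ 4 * (1 - Zsqrtd.sqrtd) ^ 2 = ⟨-32, 32⟩ ∧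
    ((1 : ℤ√(-3)) + Zsqrtd.sqrtd) ^ 5 * (1 - Zsqrtd.sqrtd) = ⟨-32, -32⟩ ∧
    ((1 : ℤ√(-3)) + Zsqrtd.sqrtd) ^ 2 * (1 - Zsqrtd.sqrtd) ^ 4 = ⟨-32, -32⟩ ∧
    ((1 : ℤ√(-3)) + Zsqrtd.sqrtd) * (1 - Zsqrtd.sqrtd) ^ 5 = ⟨-32, 32⟩ ∧
    (⟨-32, 32⟩ : ℤ√(-3)) ≠ 64 ∧ (⟨-32, -32⟩ : ℤ√(-3)) ≠ 64 := by
  decide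

/-- **NSC-SEEDS-1 LEMMA 7 / erratum to B3 (the norm-form cubic).** In a commutative ring with `ζ² + ζ + 1 = 0`, the product of the
three `ζ`-rotates `T + ζ^{-j}·aU + ζ^{j}·āV` (`j = 0, 1, 2`; `ζ^{-1} = ζ²`) is `T³ − 3aā·TUV + a³U³ + ā³V³`. Read with
`T = b·θ`, `U = x²⊗σ`, `V = y²⊗σ` (B3's quaternionic triangle) the middle term is the parasitic class `−3b·N(a)·θ·x²·y²`; read with
`T = ℓ⁺`, `U + V`-part the `N⁻`-component of a divisor class on `P₀` it is LEMMA 7 of the report. [`linear_combination`] -/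
theorem nsc1_norm_form_cubic {R : Type*} [CommRing R] (ζ T U V a abar : R) (hζ : ζ ^ 2 + ζ + 1 = 0) :
    (T + a * U + abar * V) * (T + ζ ^ 2 * (a * U) + ζ * (abar * V)) * (T + ζ * (a * U) + ζ ^ 2 * (abar * V)) =
      T ^ 3 - 3 * (a * abar) * (T * U * V) + a ^ 3 * U ^ 3 + abar ^ 3 * V ^ 3 := by
  linear_combination
    (T + a * U + abar * V) * ((a * U) * (abar * V) * ζ ^ 2 + ((a * U) ^ 2 + (abar * V) ^ 2 - (a * U) * (abar * V)) * ζ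
      + (T * (a * U) + T * (abar * V) + (a * U) * (abar * V) - (a * U) ^ 2 - (abar * V) ^ 2)) * hζ

/-- **NSC-SEEDS-1 LEMMA 4 (the non-split obstruction for sub-torus galleries, arithmetic half).** If `κ ≠ 0` then there are no rationals
with `a² + 3b² = κ` and `c² + 3d² = 2κ`: by Brahmagupta's identity `(ca + 3db)² + 3(da − cb)² = (c² + 3d²)(a² + 3b²) = 2κ²`, so
`((ca+3db)/κ)² + 3((da−cb)/κ)² = 2`, contradicting `2 ∉ Nm(ℚ(√−3)ˣ)` (`not_exists_sq_add_three_sq_eq_two`, ring-2). In the report: the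
diagonal coefficients of the class of a translated abelian threefold `Γ ⊂ E³ × Ē³` are the norms `N(p_T)` of the Plücker coordinates of a
`K`-rational 3-plane, and `[Γ]`'s (or its `S`-orbit's) diagonal part is `∝ h³` only if `N(p_T) = κ·m_{T^c} ∈ {κ, 2κ}` with both values
attained — impossible. [cite: vanGeemen1994HodgeAV, 4.14 and (5.4.1)] -/
theorem nsc1_no_norm_ratio_two (κ : ℚ) (hκ : κ ≠ 0) :
    ¬ ∃ a b c d : ℚ, a ^ 2 + 3 * b ^ 2 = κ ∧ c ^ 2 + 3 * d ^ 2 = 2 * κ := by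
  rintro ⟨a, b, c, d, hab, hcd⟩
  apply Summit.HodgeConjecture.Ring2AbelianAll.NonsplitNormObstruction.not_exists_sq_add_three_sq_eq_two
  refine ⟨(c * a + 3 * d * b) / κ, (d * a - c * b) / κ, ?_⟩
  have hB : (c * a + 3 * d * b) ^ 2 + 3 * (d * a - c * b) ^ 2 = 2 * κ ^ 2 := by
    have : (c * a + 3 * d * b) ^ 2 + 3 * (d * a - c * b) ^ 2 = (c ^ 2 + 3 * d ^ 2) * (a ^ 2 + 3 * b ^ 2) := by ring
    rw [this, hab, hcd]; ring
  field_simp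
  linear_combination hB

end NscSeedsOne

section NscSeedsOneAddendum

/-- **NSC-SEEDS-1 ADDENDUM 1, THEOREM EQ″ (arithmetic core).** For non-zero reals `p, q, r` with `p + q + r = 0` (the differences
`u₃ − u₂, u₁ − u₃, u₂ − u₁` of three distinct ratios `u_k = α_k/δ_k`), `1/p + 1/q + 1/r ≠ 0` — indeed `pq + qr + rp = −(p² + pq + q²) < 0`.
In the report this is the step `Σ_k α_k/λ_k ≠ 0` that forces `rank B₀ ≤ 1`, hence a vanishing Weil part, for divisor triples with separately
proportional K-symmetric blocks. [`nlinarith`] -/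
theorem nsc1_cyclic_reciprocal_ne_zero (p q r : ℝ) (hp : p ≠ 0) (hq : q ≠ 0) (hr : r ≠ 0) (hsum : p + q + r = 0) :
    1 / p + 1 / q + 1 / r ≠ 0 := by
  have hr' : r = -(p + q) := by linarith
  have hkey : p * q + q * r + r * p = -(p ^ 2 + p * q + q ^ 2) := by rw [hr']; ring
  have hpos : 0 < p ^ 2 + p * q + q ^ 2 := by
    nlinarith [sq_nonneg (p + q), sq_nonneg p, sq_nonneg q, sq_pos_of_pos (show (0:ℝ) < 1 by norm_num),
      mul_self_pos.2 hp, mul_self_pos.2 hq]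
  intro h
  have h2 : (1 / p + 1 / q + 1 / r) * (p * q * r) = p * q + q * r + r * p := by
    field_simp
    ring
  rw [h, zero_mul] at h2
  linarith

/-- **NSC-SEEDS-1 ADDENDUM 1, THEOREM CUBE-n (combinatorial core).** For `n ≥ 2` there are more than two `n`-subsets of a `2n`-set
(`C(2n, n) ≥ 3`): so Jacobi's complementary-minor identity for `C_n(H) = q′I + cE_{S₀T₀} + c̄E_{T₀S₀}` has a diagonal position outside
`{S₀, T₀}`, which forces `|c|² = 0`; for `n = 1` there is none (`C(2,1) = 2`), matching the genuine exception of Weil-type abelian surfaces.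
[Mathlib `Nat.succ_le_centralBinom`-type bound; here from `Nat.four_pow_le_two_mul_self_mul_centralBinom`] -/
theorem nsc1_centralBinom_gt_two (n : ℕ) (hn : 2 ≤ n) : 2 < Nat.centralBinom n := by
  have h4 : 4 ^ n ≤ 2 * n * Nat.centralBinom n := Nat.four_pow_le_two_mul_self_mul_centralBinom n (by omega)
  by_contra hlt
  have hle : Nat.centralBinom n ≤ 2 := not_lt.mp hlt
  have h8 : 4 ^ n ≤ 4 * n := by
    calc 4 ^ n ≤ 2 * n * Nat.centralBinom n := h4
      _ ≤ 2 * n * 2 := Nat.mul_le_mul_left _ hle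
      _ = 4 * n := by ring
  -- 4^n > 4n for n ≥ 2: induction-free via 4^n ≥ 16 * 4^(n-2) ≥ ... use n ≤ 2^n ≤ ... ; simplest: 4 * n < 4 ^ n for n ≥ 2
  have key : ∀ m : ℕ, 4 * (m + 2) < 4 ^ (m + 2) := by
    intro m
    induction m with
    | zero => norm_num
    | succ k ih =>
      have : 4 ^ (k + 1 + 2) = 4 * 4 ^ (k + 2) := by ring
      rw [this]; omega
  obtain ⟨m, rfl⟩ : ∃ m, n = m + 2 := ⟨n - 2, by omega⟩
  exact absurd h8 (not_le.2 (key m))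

end NscSeedsOneAddendum

section NscSeedsOneAddendumTwo

/-- **NSC-SEEDS-1 ADDENDUM 2, THEOREM PROP (K-antisymmetric parts on one complex line) — the algebraic core of its rank-one step
(report §11.1, step (3)).** For nef divisor classes `ℓ_k = ℓ⁺_k + β_k·t` (`k = 1,2,3`, `β_k` real, `β₁, β₂ > 0 > β₃`) with
`ℓ₁ℓ₂ℓ₃ ∈ ℝh³ ⊕ W`, the K-type `(5,1)` part of the product forces `A₃ = −β₃(A₁/β₁ + A₂/β₂)` on the `V_α`-blocks, and the K-type
`(4,2)`, block-bidegree `(5,1)` part forces `β₁·Cof(A₂,A₃) + β₂·Cof(A₁,A₃) + β₃·Cof(A₁,A₂) = 0`, `Cof` the polarised adjugate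
(symmetric, bilinear, positive semi-definite on positive semi-definite arguments). Substituting the first into the second gives
`−(β₃ / 2β₁β₂)·[Cof(X,X) + β₂²·Cof(A₁,A₁) + β₁²·Cof(A₂,A₂)]` with `X = β₂A₁ + β₁A₂` — three positive semi-definite terms, whence
`rank A₁, rank A₂, rank X ≤ 1` and `D₃(A₁,A₂,A₃) = 0`, contradicting `q ≠ 0`. Because `Cof` is symmetric and bilinear, that
substitution is the specialisation (`Cof(u,v) ↦ u·v` in the symmetric algebra) of the polynomial identity below, stated with the
division cleared: if `β₁β₂·a₃ = −β₃(β₂a₁ + β₁a₂)` then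
`2β₁β₂·(β₁·a₂a₃ + β₂·a₁a₃ + β₃·a₁a₂) = −β₃·((β₂a₁ + β₁a₂)² + (β₂a₁)² + (β₁a₂)²)`. [`linear_combination`] -/
theorem nsc1_prop_polarization {R : Type*} [CommRing R] (β₁ β₂ β₃ a₁ a₂ a₃ : R)
    (h : β₁ * β₂ * a₃ = -(β₃ * (β₂ * a₁ + β₁ * a₂))) :
    2 * β₁ * β₂ * (β₁ * (a₂ * a₃) + β₂ * (a₁ * a₃) + β₃ * (a₁ * a₂)) =
      -(β₃ * ((β₂ * a₁ + β₁ * a₂) ^ 2 + (β₂ * a₁) ^ 2 + (β₁ * a₂) ^ 2)) := by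
  linear_combination (2 * (β₂ * a₁ + β₁ * a₂)) * h

/-- **NSC-SEEDS-1 ADDENDUM 2, THEOREM PROP — the sign step (report §11.1, step (2)(i)).** If the three proportionality constants have
reciprocals in an open half-plane (after a rotation: positive real parts `c_k > 0`), the K-type `(5,1)` relation `Σ_k ℓ⁺_k / z_k = 0`
has hermitian part `Σ_k c_k·ℓ⁺_k = 0` with `ℓ⁺_k ⪰ 0`; evaluated on any vector this is `c₁s₁ + c₂s₂ + c₃s₃ = 0` with `s_k ≥ 0`,
forcing `s_k = 0` — all K-symmetric parts vanish, and a purely K-antisymmetric class is nef only if it is `0`. [`nlinarith`] -/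
theorem nsc1_prop_sign_step (c₁ c₂ c₃ s₁ s₂ s₃ : ℝ) (hc₁ : 0 < c₁) (hc₂ : 0 < c₂) (hc₃ : 0 < c₃)
    (hs₁ : 0 ≤ s₁) (hs₂ : 0 ≤ s₂) (hs₃ : 0 ≤ s₃) (h : c₁ * s₁ + c₂ * s₂ + c₃ * s₃ = 0) :
    s₁ = 0 ∧ s₂ = 0 ∧ s₃ = 0 := by
  refine ⟨?_, ?_, ?_⟩ <;> nlinarith [mul_nonneg hc₁.le hs₁, mul_nonneg hc₂.le hs₂, mul_nonneg hc₃.le hs₃]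

end NscSeedsOneAddendumTwo

end Summit.HodgeConjecture.HodgeConjecture.WeilTypeLadder
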